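import Literature.MathematicalPhysics.QuantumFieldTheory.Balaban1983to89.B5Local114

/-!
# `Balaban1983to89.B5SupWalk125` — Bałaban CMP 95 (1984), Proposition 1.2, STEP S1 AS PRINTED: the random walk
# (1.123) estimated in the SUP/HÖLDER currency of pp. 37–38 — the factor estimates (1.125), (1.128), (1.129), the
# one-factor term (1.130) and the walk sum (1.131) — over a general normed carrier (one instance, one cube scale)

statement-level skeleton of published theorems with citation tags; proofs where landed; nothing here is a claim
about the Yang–Mills mass gap

Source (lit-balaban cell, Phase-2 proof seat p37 gen 8): T. Bałaban, *Propagators and renormalization transformations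
for lattice gauge theories. I*, Commun. Math. Phys. **95** (1984) 17–40 [`Balaban1984PropagatorsI`, "B5"], pp. 36–39
[PDF 20–23]; held as `paper:balaban1984-cmp95-propagators-rt-i` (pages p0020–p0023 read this session; the displays are
also quoted, render-certified, in the headers of `B5Local114` / `B5Commutator128`).  Unit `lit-balaban-p37`, HOME
`run/shared/lean/pub/lit-balaban/` (SKELETON rows B5.Prop1.2, B5.Eq1.123, B5.Eq1.125, B5.Eq1.128, B5.Eq1.130, B5.Eq1.131;
owner r02).

v1.1 (docstring-only; declarations byte-identical to v1 p306559), r05 SECOND-READ-B5 pass 17-(b) CITELOC: (1.125) and the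
sentences «We represent G by the sum in (1.123) and we estimate the norm ‖ζ∇G∇*J‖_α by the sum of norms», «The factors with G
are estimated by using (1.115)» are printed on p. 38 [PDF 22] ll. 2–5 ((1.125) is p. 38's first display; p. 37 ends «…
assuming the inequalities»), not on p. 37 — page numerals corrected below.

## WHAT IS PRINTED (verbatim)

p. 36 [PDF 20]: «A proof of Proposition 1.2 will be given in several steps. In the first step we will show that the
inequalities (1.115)–(1.117), (1.89) imply the proposition.»  p. 37 [PDF 21], (1.123): «and we get the desired
representation G = C₀(I − R)⁻¹ = Σ_{ω=(ω₀,ω₁,…,ω_n)} h_{ω₀}Gh_{ω₀}K(h_{ω₁})Gh_{ω₁}·…·h_{ω_{n−1}}K(h_{ω_n})Gh_{ω_n}, (1.123)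
where the summation is over all finite sequences ω with ω_i ∈ T^{(k+m₀)}_{M₀}. Of course the sum is convergent only if
R is small in a proper sense. This holds if M₀ is sufficiently large. For example let us prove the inequality (1.113)
assuming the inequalities (1.115)–(1.117). Let us consider ζ∇G∇*J. We represent G by the sum in (1.123) and we estimate
the norm ‖ζ∇G∇*J‖_α by the sum of norms. To estimate terms in this sum we have to understand properties of factors
in each term. There are two types of factors, with the operator G and with the operator K(h). The factors with G are
estimated by using (1.115). For the first factor we have ‖ζ∇h_zGh_zA‖_α ≤ O(1)(‖ζ‖_α + |ζ|)|h_zA|. (1.125)»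
p. 38 [PDF 22]: «Defining 2δ₀ = min{⅓δ′₀, M₀⁻¹}, we obtain |h_{z₁}K(h_{z₂})A| ≤ O(M₀⁻¹)e^{−2δ₀|z₁−z₂|}(|∇A| + |A|). (1.128)
The last factor in each term is estimated by using (1.115), (1.116)
|∇Gh_z∇*J| + |Gh_z∇*J| ≤ O(1)(‖J‖_ε + |J|) ≤ O(1)(‖J‖_{α+ε} + |J|). (1.129)  There is one possibility left yet, namely
that of the terms with one factor. Then we apply the inequality (1.117) together with (1.115), (1.116) and we get
‖ζ∇h_zGh_z∇*J‖_α ≤ O(1)(‖ζ‖_α + |ζ|)(‖J‖_{α+ε} + |J|). (1.130)  Gathering together all these estimates we obtain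
‖ζ∇G∇*J‖_α ≤ O(1)(‖ζ‖_α + |ζ|) Σ_{n=0}^∞ O(1)^{2n}M₀^{−n} Σ_{ω=(ω₀,ω₁,…,ω_n): y∈□_{ω₀}, y′∈□_{ω_n}}
e^{−2δ₀|ω₀−ω₁|}·…·e^{−2δ₀|ω_{n−1}−ω_n|}(‖J‖_{α+ε} + |J|) ≤ … (1.131)»  p. 39 [PDF 23]: «Let us notice that the constant O(1)
under the sum above is an absolute constant depending on d only, hence we can fix M₀ depending on d only, such that the
series is convergent. … The proofs of the other inequalities are exactly the same, but in the estimates of G∇*J we have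
to take a representation of G adjoint to (1.123), with the operators K(h) acting on the right.»

## WHAT THIS MODULE PROVES (kernel-checked, zero sorry) — the ONE-INSTANCE walk estimates in the PRINTED currency

The b05 module `B5Local114` kernel-checks this walk in L² (the step S1′ of `B5.prop12_of_printed_steps`: p. 39 «the
proof of inequalities (1.114) … is completed because we have proved inequalities (1.89)»), over a real INNER-PRODUCT
carrier, using Hilbert duality for the `G∇*` entries.  The displays (1.125), (1.128), (1.129), (1.130), (1.131) are
however PRINTED in sup and Hölder norms (they prove (1.110)–(1.113), the step S1).  This file redoes the one-instance
estimates of `B5Local114` §2 WITHOUT an inner product: the carrier `V` is any real seminormed space (model: lattice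
sections with the sup norm `|A|`; or with the ℓ¹ norm for the «adjoint representation»), the size `|∇A| + |A|` of
(1.128) is `‖Dg A‖ + ‖A‖` for a linear `Dg : V →ₗ Vg` into a second seminormed space (model: `∇` into tensor sections),
and the OUTPUT of an entry is measured through a linear `D : V →ₗ W` into a third seminormed space `W` (model: `W = ℝ`,
`D A = (ζ∇A)(x)` for a sup entry at `x ∈ Δ̃(y)`, or `D A = [(ζ∇A)(x) − (ζ∇A)(x′)]/|x − x′|^α` for a Hölder entry — so that
«we estimate the norm ‖ζ∇G∇*J‖_α by the sum of norms» is literally the triangle inequality in `W`).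
* `SupModel` — one instance: `G`, `Δ_a`, the partition operators `h_z` with (1.118) `Σ_z h_z² = 1` and `|h_zA| ≤ |A|`,
  (1.71), the (1.115) members `|GB|, |∇GB| ≤ O(1)|B|` (`h115`, `h115'`), and (1.128) AS PRINTED (`h128`, sup currency);
* `norm_K_le` (unpaired commutator bound, for the remainder), `tail_bound` (the product of the factors (1.128)·(1.115)
  along a walk: `(2γθ)^m × e^{−2δ₀|ω₀−ω₁|}⋯`), `first_bound` ((1.125) as the hypothesis `hF` composed with the tail);
* `terms_sum` (the `ω`-terms of (1.131) of length `m+1`: the one-factor term (1.130) `hOne` for `m = 0`, else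
  (1.125)·tail·(1.129) `hL`; terms with `y ∉ □_{ω₀}` or `y′ ∉ □_{ω_m}` vanish), `remainder_sum` (the truncation
  remainder `G·R^{M+1}`, bounded by `const·(2γθK)^M`), and **`entry_bound`** — (1.131) for ONE entry `D G src`:
  `‖D (G src)‖_W ≤ (C₁ + C_F C_L/(2γ)) ν e^{2δ₀c} (1 − 2γθK)⁻¹ e^{−δ₀ d(y,y′)}`, by the walk expansion (1.123)
  (`B5Local114.walk_expansion`, truncated with exact remainder → 0) and the walk-sum bound `B5Walk131.walkSeries_le`.
The SAME theorem serves the «representation of G adjoint to (1.123)» (p. 39) for `G∇*J`, `ζG∇*J`: instantiate the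
model on the TRANSPOSED operators with the ℓ¹ norm (the consumer's business: `B5SupWalkS1`).

## HONEST SCOPE / DIVERGENCE

(1) Abstract mechanism only: no torus operator is constructed here; (1.115)–(1.117), (1.125), (1.128)–(1.130) enter as
located printed-shape HYPOTHESES of one instance (fields of `SupModel` / arguments of `entry_bound`), exactly as in
`B5Local114` (GAPS G-B5-24 style leaves); the instantiation on the tori of record is a separate task.  (2) As in
`B5Local114` (D-b05g4.1): the Neumann series (1.123) is truncated with the exact remainder `G R^{M+1}`, shown to vanish in
the limit inside each estimate, so no operator-series convergence is presupposed.  (3) Constants ours and explicit.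
CELL BOOK-KEEPING (lit-balaban): rows B5.Eq1.123/1.125/1.128/1.130/1.131 — «printed (sup/Hölder) currency: abstract
mechanism» — and row B5.Prop1.2 (step S1); VALUE = kernel check of the printed p. 38 estimates in their printed
currency — NOT summit progress.
-/

namespace Literature.MathematicalPhysics.QuantumFieldTheory.Balaban1983to89.B5SupWalk125

open Finset
open Literature.MathematicalPhysics.QuantumFieldTheory.Balaban1983to89
open Literature.MathematicalPhysics.QuantumFieldTheory.Balaban1983to89.B5Walk131
open Literature.MathematicalPhysics.QuantumFieldTheory.Balaban1983to89.B5Local114 (Kop U walk_expansion U_apply_eq_zero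
  sum_cons_split lastSum_le le_of_forall_geom walkWeight_zero walkWeight_succ)

noncomputable section

/-! ## §1 One instance in the printed currency -/

section Model

variable {V Vg : Type} [SeminormedAddCommGroup V] [Module ℝ V] [SeminormedAddCommGroup Vg] [Module ℝ Vg]
  {S X : Type} [Fintype S] [PseudoMetricSpace X]

/-- the size `|∇A| + |A|` on the right of (1.128), with `∇` an arbitrary linear map `Dg : V →ₗ Vg` into a second
seminormed space (model: the gradient from vector sections to tensor sections, sup norms).
[cite: Balaban1984PropagatorsI, (1.128) p.38] -/
def size (Dg : V →ₗ[ℝ] Vg) (A : V) : ℝ := ‖Dg A‖ + ‖A‖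

/-- [folklore: sum of seminorms is nonnegative] -/
private theorem size_nonneg (Dg : V →ₗ[ℝ] Vg) (A : V) : 0 ≤ size Dg A :=
  add_nonneg (norm_nonneg _) (norm_nonneg _)

/-- [folklore: seminorms of `0`] -/
@[simp] private theorem size_zero (Dg : V →ₗ[ℝ] Vg) : size Dg (0 : V) = 0 := by simp [size]

/-- **One instance of the SUP-CURRENCY walk machine of pp. 36–39.**  Data: the carrier `V` (a real seminormed space —
the sections on `T_η` with `|·|`), `G = Δ_a⁻¹`, `Δ_a`, the size map `Dg = ∇`, the partition of unity `h_z = H z` over the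
finite set `S` of `M₀`-cube centres embedded by `ctr` in a pseudometric space `X`, and the printed inputs as fields:
* `h118` — (1.118) p. 36: «h is chosen in such a way that Σ_n h²(t − n) = 1, hence Σ_z h_z²(x) = 1. (1.118)»;
  `normH` — `|h_zA| ≤ |A|` (`0 ≤ h ≤ 1`) [folklore];
* `h71`, `h71'` — (1.71) p. 30: «Δ_a⁻¹ = G_k, or simply G. (1.71)», «It is an invertible operator»;
* `h115`, `h115'` — the members `|GJ|, |∇GJ| ≤ O(1)|J|` of (1.115) p. 36 («The factors with G are estimated by using
  (1.115)», p. 38), constant `γ`;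
* `h128` — (1.128) p. 38 AS PRINTED: «|h_{z₁}K(h_{z₂})A| ≤ O(M₀⁻¹)e^{−2δ₀|z₁−z₂|}(|∇A| + |A|). (1.128)», `θ = O(M₀⁻¹)`.
[cite: Balaban1984PropagatorsI, (1.118) p.36, (1.71) p.30, (1.115) p.36, (1.128) p.38] -/
structure SupModel (V Vg : Type) [SeminormedAddCommGroup V] [Module ℝ V] [SeminormedAddCommGroup Vg] [Module ℝ Vg]
    (S X : Type) [Fintype S] [PseudoMetricSpace X] where
  /-- `G = Δ_a⁻¹`. -/
  G : Module.End ℝ V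
  /-- `Δ_a`. -/
  Δa : Module.End ℝ V
  /-- the partition of unity `h_z`, (1.118). -/
  H : S → Module.End ℝ V
  /-- the gradient `∇` as a size map. -/
  Dg : V →ₗ[ℝ] Vg
  /-- cube centres. -/
  ctr : S → X
  /-- the `O(1)` of (1.115) for `|GJ|, |∇GJ|`. -/
  γ : ℝ
  /-- `θ = O(M₀⁻¹)` of (1.128). -/
  θ : ℝ
  /-- `δ₀` of (1.128). -/
  δ₀ : ℝ
  /-- half-width of the cubes `□_z` in `X`. -/
  c : ℝ
  h118 : ∑ z, H z * H z = 1
  h71 : Δa * G = 1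
  h71' : G * Δa = 1
  normH : ∀ (z : S) (v : V), ‖H z v‖ ≤ ‖v‖
  h115 : ∀ B : V, ‖G B‖ ≤ γ * ‖B‖
  h115' : ∀ B : V, ‖Dg (G B)‖ ≤ γ * ‖B‖
  h128 : ∀ (z₁ z₂ : S) (A : V),
    ‖H z₁ (Kop Δa H z₂ A)‖ ≤ θ * Real.exp (-(2 * δ₀ * dist (ctr z₁) (ctr z₂))) * (‖Dg A‖ + ‖A‖)
  γ_pos : 0 < γ
  θ_nonneg : 0 ≤ θ
  δ₀_nonneg : 0 ≤ δ₀

namespace SupModel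

variable (M : SupModel V Vg S X)

/-- `|∇(GB)| + |GB| ≤ 2γ|B|` from (1.115). [cite: Balaban1984PropagatorsI, (1.115) p.36] -/
theorem size_G_le (w : V) : size M.Dg (M.G w) ≤ 2 * M.γ * ‖w‖ := by
  unfold size; have := M.h115 w; have := M.h115' w; linarith

/-- The UNPAIRED commutator bound `|K(h_z)u| ≤ θ K (|∇u| + |u|)`, from (1.128) by inserting `Σ_{z₁} h_{z₁}² = 1`
(1.118); used only for the remainder `G R^{M+1}`. [cite: Balaban1984PropagatorsI, (1.128) p.38, (1.118) p.36] -/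
theorem norm_K_le {K : ℝ} (hrow : ∀ a : S, ∑ b : S, Real.exp (-(M.δ₀ * dist (M.ctr a) (M.ctr b))) ≤ K)
    (z : S) (u : V) : ‖Kop M.Δa M.H z u‖ ≤ M.θ * K * size M.Dg u := by
  -- row sums at rate `2δ₀` are bounded by row sums at rate `δ₀` (cf. `B5Local114.Model.col_two_le`)
  have hcol : ∀ b : S, ∑ a : S, Real.exp (-(2 * M.δ₀ * dist (M.ctr a) (M.ctr b))) ≤ K := fun b => by
    refine le_trans (Finset.sum_le_sum fun a _ => ?_) (hrow b)
    rw [dist_comm]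
    apply Real.exp_le_exp.mpr
    have := mul_nonneg M.δ₀_nonneg (dist_nonneg : 0 ≤ dist (M.ctr b) (M.ctr a))
    linarith
  have hexp : Kop M.Δa M.H z u = ∑ z₁, M.H z₁ (M.H z₁ (Kop M.Δa M.H z u)) := by
    have := LinearMap.congr_fun M.h118 (Kop M.Δa M.H z u)
    simp only [LinearMap.sum_apply, Module.End.mul_apply, Module.End.one_apply] at this
    exact this.symm
  have hre : ∀ z₁, M.θ * Real.exp (-(2 * M.δ₀ * dist (M.ctr z₁) (M.ctr z))) * size M.Dg u
      = (M.θ * size M.Dg u) * Real.exp (-(2 * M.δ₀ * dist (M.ctr z₁) (M.ctr z))) := by intro; ring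
  calc ‖Kop M.Δa M.H z u‖ = ‖∑ z₁, M.H z₁ (M.H z₁ (Kop M.Δa M.H z u))‖ := congrArg _ hexp
    _ ≤ ∑ z₁, ‖M.H z₁ (M.H z₁ (Kop M.Δa M.H z u))‖ := norm_sum_le _ _
    _ ≤ ∑ z₁, ‖M.H z₁ (Kop M.Δa M.H z u)‖ := Finset.sum_le_sum fun z₁ _ => M.normH _ _
    _ ≤ ∑ z₁, M.θ * Real.exp (-(2 * M.δ₀ * dist (M.ctr z₁) (M.ctr z))) * size M.Dg u :=
        Finset.sum_le_sum fun z₁ _ => M.h128 z₁ z u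
    _ = (M.θ * size M.Dg u) * ∑ z₁, Real.exp (-(2 * M.δ₀ * dist (M.ctr z₁) (M.ctr z))) := by
        simp_rw [hre]; rw [Finset.mul_sum]
    _ ≤ (M.θ * size M.Dg u) * K :=
        mul_le_mul_of_nonneg_left (hcol z) (mul_nonneg M.θ_nonneg (size_nonneg _ _))
    _ = M.θ * K * size M.Dg u := by ring

/-- **The product estimate along one walk** (the factors of (1.131), p. 38 «The factors with G are estimated by using
(1.115)» + (1.128)): for `u = U_ω B`, `|∇u| + |u| ≤ (2γθ)^m e^{−2δ₀|ω₀−ω₁|}⋯e^{−2δ₀|ω_{m−1}−ω_m|}(|∇Gh_{ω_m}B| + |Gh_{ω_m}B|)`.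
[cite: Balaban1984PropagatorsI, (1.128), (1.131) p.38, (1.115) p.36] -/
theorem tail_bound : ∀ (m : ℕ) (ω : Fin (m + 1) → S) (B : V),
    size M.Dg (U M.G M.H (Kop M.Δa M.H) m ω B)
      ≤ (2 * M.γ * M.θ) ^ m * walkWeight M.ctr (2 * M.δ₀) m ω * size M.Dg (M.G (M.H (ω (Fin.last m)) B)) := by
  intro m
  induction m with
  | zero =>
    intro ω B
    simp [walkWeight, Module.End.mul_apply]
  | succ m ih =>
    intro ω B
    have hU : U M.G M.H (Kop M.Δa M.H) (m + 1) ω B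
        = M.G (M.H (ω 0) (Kop M.Δa M.H (Fin.tail ω 0) (U M.G M.H (Kop M.Δa M.H) m (Fin.tail ω) B))) := by
      simp [Module.End.mul_apply]
    have hlast : (Fin.tail ω) (Fin.last m) = ω (Fin.last (m + 1)) := by
      simp [Fin.tail, Fin.succ_last]
    have ih' := ih (Fin.tail ω) B
    rw [hlast] at ih'
    have h2 := M.h128 (ω 0) (Fin.tail ω 0) (U M.G M.H (Kop M.Δa M.H) m (Fin.tail ω) B)
    have hE0 : 0 ≤ Real.exp (-(2 * M.δ₀ * dist (M.ctr (ω 0)) (M.ctr (Fin.tail ω 0)))) := (Real.exp_pos _).le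
    have hW0 : 0 ≤ walkWeight M.ctr (2 * M.δ₀) m (Fin.tail ω) := walkWeight_nonneg _ _ _ _
    have hL0 : 0 ≤ size M.Dg (M.G (M.H (ω (Fin.last (m + 1))) B)) := size_nonneg _ _
    have hγ := M.γ_pos
    have hθ := M.θ_nonneg
    have hΘ0 : 0 ≤ 2 * M.γ * M.θ := by positivity
    rw [hU, walkWeight_succ]
    calc size M.Dg (M.G (M.H (ω 0) (Kop M.Δa M.H (Fin.tail ω 0) (U M.G M.H (Kop M.Δa M.H) m (Fin.tail ω) B))))
        ≤ 2 * M.γ * ‖M.H (ω 0) (Kop M.Δa M.H (Fin.tail ω 0) (U M.G M.H (Kop M.Δa M.H) m (Fin.tail ω) B))‖ :=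
          M.size_G_le _
      _ ≤ 2 * M.γ * (M.θ * Real.exp (-(2 * M.δ₀ * dist (M.ctr (ω 0)) (M.ctr (Fin.tail ω 0))))
            * size M.Dg (U M.G M.H (Kop M.Δa M.H) m (Fin.tail ω) B)) := by
          gcongr; exact h2
      _ ≤ 2 * M.γ * (M.θ * Real.exp (-(2 * M.δ₀ * dist (M.ctr (ω 0)) (M.ctr (Fin.tail ω 0))))
            * ((2 * M.γ * M.θ) ^ m * walkWeight M.ctr (2 * M.δ₀) m (Fin.tail ω)
                * size M.Dg (M.G (M.H (ω (Fin.last (m + 1))) B)))) := by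
          gcongr
      _ = (2 * M.γ * M.θ) ^ (m + 1) * (Real.exp (-(2 * M.δ₀ * dist (M.ctr (ω 0)) (M.ctr (Fin.tail ω 0))))
            * walkWeight M.ctr (2 * M.δ₀) m (Fin.tail ω)) * size M.Dg (M.G (M.H (ω (Fin.last (m + 1))) B)) := by
          ring

variable {W : Type} [SeminormedAddCommGroup W] [Module ℝ W]

/-- **The first factor of a walk term, (1.125) p. 38: «For the first factor we have
‖ζ∇h_zGh_zA‖_α ≤ O(1)(‖ζ‖_α + |ζ|)|h_zA|. (1.125)»**, as the hypothesis `hF : ‖D (h_z G B)‖_W ≤ C_F |B|` for the output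
map `D` of the entry (model: `D = ζ∇` read at a point or through a Hölder quotient, `C_F = O(1)(‖ζ‖_α + |ζ|)`), combined
with `tail_bound`: the `ω`-term of length `m+2` is at most `C_F θ (2γθ)^m × weight × last factor`.
[cite: Balaban1984PropagatorsI, (1.125), (1.128), (1.131) p.38] -/
theorem first_bound {D : V →ₗ[ℝ] W} {CF : ℝ} (hF : ∀ (z : S) (B : V), ‖D (M.H z (M.G B))‖ ≤ CF * ‖B‖)
    (hCF : 0 ≤ CF) (m : ℕ) (ω : Fin (m + 1 + 1) → S) (B : V) :
    ‖D (M.H (ω 0) (U M.G M.H (Kop M.Δa M.H) (m + 1) ω B))‖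
      ≤ CF * M.θ * (2 * M.γ * M.θ) ^ m * walkWeight M.ctr (2 * M.δ₀) (m + 1) ω
          * size M.Dg (M.G (M.H (ω (Fin.last (m + 1))) B)) := by
  have hU : U M.G M.H (Kop M.Δa M.H) (m + 1) ω B
      = M.G (M.H (ω 0) (Kop M.Δa M.H (Fin.tail ω 0) (U M.G M.H (Kop M.Δa M.H) m (Fin.tail ω) B))) := by
    simp [Module.End.mul_apply]
  have hlast : (Fin.tail ω) (Fin.last m) = ω (Fin.last (m + 1)) := by
    simp [Fin.tail, Fin.succ_last]
  have ht := M.tail_bound m (Fin.tail ω) B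
  rw [hlast] at ht
  have h2 := M.h128 (ω 0) (Fin.tail ω 0) (U M.G M.H (Kop M.Δa M.H) m (Fin.tail ω) B)
  have hE0 : 0 ≤ Real.exp (-(2 * M.δ₀ * dist (M.ctr (ω 0)) (M.ctr (Fin.tail ω 0)))) := (Real.exp_pos _).le
  have hW0 : 0 ≤ walkWeight M.ctr (2 * M.δ₀) m (Fin.tail ω) := walkWeight_nonneg _ _ _ _
  have hL0 : 0 ≤ size M.Dg (M.G (M.H (ω (Fin.last (m + 1))) B)) := size_nonneg _ _
  have hγ := M.γ_pos
  have hθ := M.θ_nonneg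
  have hΘ0 : 0 ≤ 2 * M.γ * M.θ := by positivity
  rw [hU, walkWeight_succ]
  calc ‖D (M.H (ω 0) (M.G (M.H (ω 0) (Kop M.Δa M.H (Fin.tail ω 0) (U M.G M.H (Kop M.Δa M.H) m (Fin.tail ω) B)))))‖
      ≤ CF * ‖M.H (ω 0) (Kop M.Δa M.H (Fin.tail ω 0) (U M.G M.H (Kop M.Δa M.H) m (Fin.tail ω) B))‖ := hF _ _
    _ ≤ CF * (M.θ * Real.exp (-(2 * M.δ₀ * dist (M.ctr (ω 0)) (M.ctr (Fin.tail ω 0))))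
            * size M.Dg (U M.G M.H (Kop M.Δa M.H) m (Fin.tail ω) B)) := by
        gcongr; exact h2
    _ ≤ CF * (M.θ * Real.exp (-(2 * M.δ₀ * dist (M.ctr (ω 0)) (M.ctr (Fin.tail ω 0))))
            * ((2 * M.γ * M.θ) ^ m * walkWeight M.ctr (2 * M.δ₀) m (Fin.tail ω)
                * size M.Dg (M.G (M.H (ω (Fin.last (m + 1))) B)))) := by
        gcongr
    _ = CF * M.θ * (2 * M.γ * M.θ) ^ m * (Real.exp (-(2 * M.δ₀ * dist (M.ctr (ω 0)) (M.ctr (Fin.tail ω 0))))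
            * walkWeight M.ctr (2 * M.δ₀) m (Fin.tail ω)) * size M.Dg (M.G (M.H (ω (Fin.last (m + 1))) B)) := by
        ring

/-! ## §2 The terms of (1.131), the remainder, and the entry theorem -/

/-- **The `ω`-terms of (1.131) of length `m+1` for ONE entry `D G src`** (output map `D` localised near `y`, source
`src` — `J`, `∇*J`, … — localised near `y′`): their sum is at most `(C₁ + C_F C_L/(2γ))·(2γθ)^m × walkSum`.  The term
`m = 0` is the one-factor term (1.130) (`hOne`: «‖ζ∇h_zGh_z∇*J‖_α ≤ O(1)(‖ζ‖_α + |ζ|)(‖J‖_{α+ε} + |J|). (1.130)»), the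
terms `m ≥ 1` use the first factor (1.125) (`hF`), `tail_bound` and the last factor (1.129) (`hL`: «The last factor in
each term is estimated by using (1.115), (1.116) |∇Gh_z∇*J| + |Gh_z∇*J| ≤ O(1)(‖J‖_ε + |J|) ≤ O(1)(‖J‖_{α+ε} + |J|).
(1.129)»); terms with `y ∉ □_{ω₀}` or `y′ ∉ □_{ω_m}` vanish (`hDloc`, `hJloc`: «ω: y ∈ □_{ω₀}, y′ ∈ □_{ω_n}» under the sum
of (1.131)). [cite: Balaban1984PropagatorsI, (1.125)–(1.131) p.38] -/
theorem terms_sum {D : V →ₗ[ℝ] W} {CF CL C1 nJ : ℝ} (hCF : 0 ≤ CF) (hCL : 0 ≤ CL) (hC1 : 0 ≤ C1)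
    (hnJ : 0 ≤ nJ) {y y' : X} {src : V}
    (hF : ∀ (z : S) (B : V), ‖D (M.H z (M.G B))‖ ≤ CF * ‖B‖)
    (hDloc : ∀ z, ¬ dist y (M.ctr z) ≤ M.c → D ∘ₗ M.H z = 0)
    (hJloc : ∀ z, ¬ dist (M.ctr z) y' ≤ M.c → M.H z src = 0)
    (hL : ∀ z, size M.Dg (M.G (M.H z src)) ≤ CL * nJ)
    (hOne : ∀ z, ‖D (M.H z (M.G (M.H z src)))‖ ≤ C1 * nJ) (m : ℕ) :
    ∑ ω : Fin (m + 1) → S, ‖D (M.H (ω 0) (U M.G M.H (Kop M.Δa M.H) m ω src))‖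
      ≤ (C1 + CF * CL / (2 * M.γ)) * nJ * ((2 * M.γ * M.θ) ^ m * walkSum M.ctr M.δ₀ M.c m y y') := by
  have hγ := M.γ_pos
  have hθ := M.θ_nonneg
  have hΘ0 : 0 ≤ 2 * M.γ * M.θ := by positivity
  have hA0 : 0 ≤ CF * CL / (2 * M.γ) := by positivity
  unfold walkSum
  rw [Finset.mul_sum, Finset.mul_sum]
  refine Finset.sum_le_sum fun ω _ => ?_
  split_ifs with h
  · cases m with
    | zero =>
      rw [walkWeight_zero, pow_zero, mul_one, mul_one]
      calc ‖D (M.H (ω 0) (U M.G M.H (Kop M.Δa M.H) 0 ω src))‖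
          = ‖D (M.H (ω 0) (M.G (M.H (ω 0) src)))‖ := by simp [Module.End.mul_apply]
        _ ≤ C1 * nJ := hOne _
        _ ≤ (C1 + CF * CL / (2 * M.γ)) * nJ := by
            have : 0 ≤ CF * CL / (2 * M.γ) * nJ := by positivity
            nlinarith
    | succ m =>
      set Wt := walkWeight M.ctr (2 * M.δ₀) (m + 1) ω with hWt
      have hW0 : 0 ≤ Wt := walkWeight_nonneg _ _ _ _
      have hfb := M.first_bound hF hCF m ω src
      have hlast := hL (ω (Fin.last (m + 1)))
      have key : (C1 + CF * CL / (2 * M.γ)) * nJ * ((2 * M.γ * M.θ) ^ (m + 1) * Wt)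
          = C1 * nJ * ((2 * M.γ * M.θ) ^ (m + 1) * Wt)
            + CF * M.θ * (2 * M.γ * M.θ) ^ m * Wt * (CL * nJ) := by
        field_simp
        ring
      rw [key]
      have hpos : 0 ≤ C1 * nJ * ((2 * M.γ * M.θ) ^ (m + 1) * Wt) := by positivity
      calc ‖D (M.H (ω 0) (U M.G M.H (Kop M.Δa M.H) (m + 1) ω src))‖
          ≤ CF * M.θ * (2 * M.γ * M.θ) ^ m * Wt * size M.Dg (M.G (M.H (ω (Fin.last (m + 1))) src)) := hfb
        _ ≤ CF * M.θ * (2 * M.γ * M.θ) ^ m * Wt * (CL * nJ) := by gcongr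
        _ ≤ _ := by linarith
  · rw [mul_zero, mul_zero]
    rw [not_and_or] at h
    rcases h with hy | hy'
    · have hz := LinearMap.congr_fun (hDloc (ω 0) hy) (U M.G M.H (Kop M.Δa M.H) m ω src)
      simp only [LinearMap.comp_apply, LinearMap.zero_apply] at hz
      rw [hz, norm_zero]
    · have hU := U_apply_eq_zero M.G M.H (Kop M.Δa M.H) m ω src (hJloc _ hy')
      rw [hU]; simp

/-- **The remainder `Σ_ω D G K(h_{ω₀}) U_ω src` of the truncated expansion**: at most
`C_F θK C_L n_J ν (2γθK)^M`, which tends to `0` as `M → ∞` since `2γθK < 1` (p. 39 «we can fix M₀ … such that the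
series is convergent»). [cite: Balaban1984PropagatorsI, (1.131) p.38, p.39] -/
theorem remainder_sum {D : V →ₗ[ℝ] W} {CF CL nJ K ν : ℝ} (hCF : 0 ≤ CF) (hCL : 0 ≤ CL)
    (hnJ : 0 ≤ nJ) (hK : 0 ≤ K) {y' : X} {src : V}
    (hrow : ∀ a : S, ∑ b : S, Real.exp (-(M.δ₀ * dist (M.ctr a) (M.ctr b))) ≤ K)
    (hν : ((Finset.univ.filter fun z : S => dist y' (M.ctr z) ≤ M.c).card : ℝ) ≤ ν)
    (hDG : ∀ B : V, ‖D (M.G B)‖ ≤ CF * ‖B‖)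
    (hJloc : ∀ z, ¬ dist (M.ctr z) y' ≤ M.c → M.H z src = 0)
    (hL : ∀ z, size M.Dg (M.G (M.H z src)) ≤ CL * nJ) (Mm : ℕ) :
    ∑ ω : Fin (Mm + 1) → S, ‖D (M.G (Kop M.Δa M.H (ω 0) (U M.G M.H (Kop M.Δa M.H) Mm ω src)))‖
      ≤ CF * (M.θ * K) * (CL * nJ) * ν * ((2 * M.γ * M.θ) ^ Mm * K ^ Mm) := by
  have hγ := M.γ_pos
  have hθ := M.θ_nonneg
  have hΘ0 : 0 ≤ 2 * M.γ * M.θ := by positivity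
  have hcol : ∀ b : S, ∑ a : S, Real.exp (-(2 * M.δ₀ * dist (M.ctr a) (M.ctr b))) ≤ K := fun b => by
    refine le_trans (Finset.sum_le_sum fun a _ => ?_) (hrow b)
    rw [dist_comm]
    apply Real.exp_le_exp.mpr
    have := mul_nonneg M.δ₀_nonneg (dist_nonneg : 0 ≤ dist (M.ctr b) (M.ctr a))
    linarith
  set ind : S → ℝ := fun z => if dist y' (M.ctr z) ≤ M.c then 1 else 0 with hind
  have h0 : ∀ z, 0 ≤ ind z := by intro z; simp only [hind]; split_ifs <;> norm_num
  have hνsum : ∑ z, ind z ≤ ν := by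
    have : ∑ z, ind z = ((Finset.univ.filter fun z : S => dist y' (M.ctr z) ≤ M.c).card : ℝ) := by
      simp only [hind]
      rw [Finset.sum_boole]
    rw [this]; exact hν
  have hlast : ∀ ω : Fin (Mm + 1) → S,
      size M.Dg (M.G (M.H (ω (Fin.last Mm)) src)) ≤ CL * nJ * ind (ω (Fin.last Mm)) := by
    intro ω
    simp only [hind]
    split_ifs with hc
    · rw [mul_one]; exact hL _
    · have : ¬ dist (M.ctr (ω (Fin.last Mm))) y' ≤ M.c := by rwa [dist_comm] at hc
      rw [hJloc _ this, map_zero, size_zero, mul_zero]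
  have hterm : ∀ ω : Fin (Mm + 1) → S,
      ‖D (M.G (Kop M.Δa M.H (ω 0) (U M.G M.H (Kop M.Δa M.H) Mm ω src)))‖
        ≤ CF * (M.θ * K) * (CL * nJ) * (2 * M.γ * M.θ) ^ Mm
            * (ind (ω (Fin.last Mm)) * walkWeight M.ctr (2 * M.δ₀) Mm ω) := by
    intro ω
    set u := U M.G M.H (Kop M.Δa M.H) Mm ω src with hu
    have htb := M.tail_bound Mm ω src
    have hW0 : 0 ≤ walkWeight M.ctr (2 * M.δ₀) Mm ω := walkWeight_nonneg _ _ _ _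
    calc ‖D (M.G (Kop M.Δa M.H (ω 0) u))‖ ≤ CF * ‖Kop M.Δa M.H (ω 0) u‖ := hDG _
      _ ≤ CF * (M.θ * K * size M.Dg u) := by gcongr; exact M.norm_K_le hrow _ _
      _ ≤ CF * (M.θ * K * ((2 * M.γ * M.θ) ^ Mm * walkWeight M.ctr (2 * M.δ₀) Mm ω
            * size M.Dg (M.G (M.H (ω (Fin.last Mm)) src)))) := by gcongr
      _ ≤ CF * (M.θ * K * ((2 * M.γ * M.θ) ^ Mm * walkWeight M.ctr (2 * M.δ₀) Mm ω
            * (CL * nJ * ind (ω (Fin.last Mm))))) := by gcongr; exact hlast ω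
      _ = _ := by ring
  calc ∑ ω : Fin (Mm + 1) → S, ‖D (M.G (Kop M.Δa M.H (ω 0) (U M.G M.H (Kop M.Δa M.H) Mm ω src)))‖
      ≤ ∑ ω : Fin (Mm + 1) → S, CF * (M.θ * K) * (CL * nJ) * (2 * M.γ * M.θ) ^ Mm
            * (ind (ω (Fin.last Mm)) * walkWeight M.ctr (2 * M.δ₀) Mm ω) := Finset.sum_le_sum fun ω _ => hterm ω
    _ = CF * (M.θ * K) * (CL * nJ) * (2 * M.γ * M.θ) ^ Mm
            * ∑ ω : Fin (Mm + 1) → S, ind (ω (Fin.last Mm)) * walkWeight M.ctr (2 * M.δ₀) Mm ω := by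
        rw [Finset.mul_sum]
    _ ≤ CF * (M.θ * K) * (CL * nJ) * (2 * M.γ * M.θ) ^ Mm * (ν * K ^ Mm) := by
        apply mul_le_mul_of_nonneg_left _ (by positivity)
        exact lastSum_le M.ctr (2 * M.δ₀) K ν hK hcol ind h0 hνsum Mm
    _ = _ := by ring

/-- **ENTRY THEOREM — (1.131) in the printed currency and its conclusion for ONE entry `D G src`** (model: `D = ζ∇·`
read at `x ∈ Δ̃(y)` or through a Hölder quotient, `src = ∇*J` with `supp J ⊂ Δ̃(y′)`; equally the transposed data for the
«representation of G adjoint to (1.123)»).  From the walk expansion (1.123), the localities of `D` (near `y`) and `src`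
(near `y′`), the printed factor estimates (1.125) `hF`/`hDG`, (1.128) (in `M`), (1.129) `hL`, (1.130) `hOne`, and the
walk-sum bound `B5Walk131.walkSeries_le` ((1.131), second inequality):
`‖D (G src)‖_W ≤ (C₁ + C_F C_L/(2γ)) ν e^{2δ₀c} (1 − 2γθK)⁻¹ e^{−δ₀ d(y,y′)} n_J`, p. 39: «we can fix M₀ depending on d
only, such that the series is convergent». [cite: Balaban1984PropagatorsI, (1.123) p.37, (1.125)–(1.131) p.38, p.39] -/
theorem entry_bound {K ν : ℝ} (hK : 0 ≤ K)
    (hrow : ∀ a : S, ∑ b : S, Real.exp (-(M.δ₀ * dist (M.ctr a) (M.ctr b))) ≤ K)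
    (hν : ∀ x : X, ((Finset.univ.filter fun z : S => dist x (M.ctr z) ≤ M.c).card : ℝ) ≤ ν)
    (hsmall : 2 * M.γ * M.θ * K < 1)
    {D : V →ₗ[ℝ] W} {CF CL C1 nJ : ℝ} (hCF : 0 ≤ CF) (hCL : 0 ≤ CL) (hC1 : 0 ≤ C1)
    (hnJ : 0 ≤ nJ) {y y' : X} {src : V}
    (hF : ∀ (z : S) (B : V), ‖D (M.H z (M.G B))‖ ≤ CF * ‖B‖)
    (hDG : ∀ B : V, ‖D (M.G B)‖ ≤ CF * ‖B‖)
    (hDloc : ∀ z, ¬ dist y (M.ctr z) ≤ M.c → D ∘ₗ M.H z = 0)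
    (hJloc : ∀ z, ¬ dist (M.ctr z) y' ≤ M.c → M.H z src = 0)
    (hL : ∀ z, size M.Dg (M.G (M.H z src)) ≤ CL * nJ)
    (hOne : ∀ z, ‖D (M.H z (M.G (M.H z src)))‖ ≤ C1 * nJ) :
    ‖D (M.G src)‖
      ≤ (C1 + CF * CL / (2 * M.γ)) * ν * Real.exp (2 * M.δ₀ * M.c) * (1 - 2 * M.γ * M.θ * K)⁻¹
          * Real.exp (-(M.δ₀ * dist y y')) * nJ := by
  have hγ := M.γ_pos
  have hθ := M.θ_nonneg
  have hΘ0 : 0 ≤ 2 * M.γ * M.θ := by positivity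
  have hν0 : 0 ≤ ν := le_trans (Nat.cast_nonneg _) (hν y)
  have hq0 : 0 ≤ 2 * M.γ * M.θ * K := by positivity
  set A := (C1 + CF * CL / (2 * M.γ)) * nJ with hA
  have hA0 : 0 ≤ A := by positivity
  set Bnd := ν * Real.exp (2 * M.δ₀ * M.c) * Real.exp (-(M.δ₀ * dist y y')) * (1 - 2 * M.γ * M.θ * K)⁻¹
    with hBnd
  set Rem := CF * (M.θ * K) * (CL * nJ) * ν with hRem
  have hRem0 : 0 ≤ Rem := by positivity
  have hmain : ∀ Mm : ℕ, ‖D (M.G src)‖ ≤ A * Bnd + Rem * (2 * M.γ * M.θ * K) ^ Mm := by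
    intro Mm
    have hexp := walk_expansion (S := S) M.h118 M.h71 M.h71' Mm
    have hG : M.G src
        = ∑ m ∈ Finset.range (Mm + 1), ∑ ω : Fin (m + 1) → S,
              M.H (ω 0) (U M.G M.H (Kop M.Δa M.H) m ω src)
          + ∑ ω : Fin (Mm + 1) → S,
              M.G (Kop M.Δa M.H (ω 0) (U M.G M.H (Kop M.Δa M.H) Mm ω src)) := by
      have := LinearMap.congr_fun hexp src
      simpa only [LinearMap.add_apply, LinearMap.sum_apply, Module.End.mul_apply] using this
    have hE : D (M.G src)
        = ∑ m ∈ Finset.range (Mm + 1), ∑ ω : Fin (m + 1) → S,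
              D (M.H (ω 0) (U M.G M.H (Kop M.Δa M.H) m ω src))
          + ∑ ω : Fin (Mm + 1) → S,
              D (M.G (Kop M.Δa M.H (ω 0) (U M.G M.H (Kop M.Δa M.H) Mm ω src))) := by
      rw [hG]; simp only [map_add, map_sum]
    calc ‖D (M.G src)‖
        ≤ ‖∑ m ∈ Finset.range (Mm + 1), ∑ ω : Fin (m + 1) → S,
              D (M.H (ω 0) (U M.G M.H (Kop M.Δa M.H) m ω src))‖
          + ‖∑ ω : Fin (Mm + 1) → S,
              D (M.G (Kop M.Δa M.H (ω 0) (U M.G M.H (Kop M.Δa M.H) Mm ω src)))‖ := by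
          rw [hE]; exact norm_add_le _ _
      _ ≤ ∑ m ∈ Finset.range (Mm + 1), ∑ ω : Fin (m + 1) → S,
              ‖D (M.H (ω 0) (U M.G M.H (Kop M.Δa M.H) m ω src))‖
          + ∑ ω : Fin (Mm + 1) → S,
              ‖D (M.G (Kop M.Δa M.H (ω 0) (U M.G M.H (Kop M.Δa M.H) Mm ω src)))‖ := by
          gcongr
          · exact le_trans (norm_sum_le _ _) (Finset.sum_le_sum fun m _ => norm_sum_le _ _)
          · exact norm_sum_le _ _
      _ ≤ ∑ m ∈ Finset.range (Mm + 1), A * ((2 * M.γ * M.θ) ^ m * walkSum M.ctr M.δ₀ M.c m y y')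
          + Rem * ((2 * M.γ * M.θ) ^ Mm * K ^ Mm) := by
          gcongr with m hm
          · exact M.terms_sum hCF hCL hC1 hnJ hF hDloc hJloc hL hOne m
          · have := M.remainder_sum hCF hCL hnJ hK hrow (hν y') hDG hJloc hL Mm
            simpa only [hRem] using this
      _ = A * ∑ m ∈ Finset.range (Mm + 1), (2 * M.γ * M.θ) ^ m * walkSum M.ctr M.δ₀ M.c m y y'
          + Rem * (2 * M.γ * M.θ * K) ^ Mm := by rw [Finset.mul_sum]; ring
      _ ≤ A * Bnd + Rem * (2 * M.γ * M.θ * K) ^ Mm := by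
          gcongr
          exact walkSeries_le M.ctr M.δ₀ M.c K ν (2 * M.γ * M.θ) M.δ₀_nonneg hK hΘ0 hν0 hrow hsmall y y'
            (hν y) (Mm + 1)
  have hfin := le_of_forall_geom hq0 hsmall hmain
  calc ‖D (M.G src)‖ ≤ A * Bnd := hfin
    _ = _ := by simp only [hA, hBnd]; ring

end SupModel

end Model

end

end Literature.MathematicalPhysics.QuantumFieldTheory.Balaban1983to89.B5SupWalk125
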